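import Mathlib
import Literature.Barriers.MatrixMultiplication.QuasirandomBarrierProofs
import Summits.MatrixMultiplication.MatrixMultiplication.Theorems.SnSubsetDichotomyGlobalBranchStubBlockDictionary
import Summits.MatrixMultiplication.MatrixMultiplication.Theorems.SnSubsetDichotomyPolynomialSlackSpechtDimLower
import Summits.MatrixMultiplication.MatrixMultiplication.Theorems.SnSubsetDichotomyPolynomialSlackLowBlocks

/-!
# Level-one pinning: the dissected BCGPU identity for parity-pure TPP triples in `S_n`

The LEVEL-ONE programme on the crux `SnSubsetDichotomy.PolynomialSlack`
(stmt-MatrixMultiplication-8306), main analytic step (idea card `deficit-budget-positivity`,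
`LevelOnePinning`; Eberhard 2016's standard-representation reduction transplanted to TPP triples).

For a TPP triple `S, T, U ⊆ S_n` with `N = |S||T||U|`, the tree's proof of BCGPU 2023 Thm. 3.2 reads
`n!·N = Σᵢ dᵢ tr(zᵢ)` over the Wedderburn blocks of `ℂ[S_n]`, `z = 𝟙_{S⁻¹}𝟙_T·𝟙_{T⁻¹}𝟙_U·𝟙_{U⁻¹}𝟙_S`,
and bounds ALL blocks of dimension `> 1` through Parseval by `N·n!^{3/2}/√n(S_n)`. Here the blocks are
DISSECTED by their partition (`stub_blockDictionary`): the four blocks of level `≤ 1` —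
`(n), (1ⁿ)` of dimension `1` and `(n-1,1), (2,1^{n-2})` of dimension `n-1` — are evaluated EXACTLY
(`…LowBlocks`: for parity-pure sets they contribute `N², N², (n-1)(T₃-N²), (n-1)(T₃-N²)` with
`T₃ = Σ #fix(s⁻¹t·t'⁻¹u·u'⁻¹s')` the six-fold fixed-point count), and only the remaining blocks, all
of dimension `≥ D = n(n-1)/6` (`quadratic_le_numStandardTableaux`, weak Rasala), are bounded through
Parseval, by `N·n!^{3/2}/√D`. The result (`levelOnePinning`):

  `2(n-1)·(N² - T₃) ≥ 2N² - n!·N - N·n!·√(n!)/√D`   (`n ≥ 40`, parity-pure TPP triple).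

In the window `12·(n!)^{3/2}/n ≤ N` (slack exponent `C < 1`) the right-hand side is `≥ 1.7·N²`, i.e.
`E[fix] - 1 = (T₃ - N²)/N² ≤ -0.85/(n-1)`: the composite of three independent quotient elements has
FEWER fixed points than a random permutation — the level-one datum every proof of the crux in the
first window must exploit. Every TPP triple has a parity-pure TPP sub-triple with `N' ≥ N/8`.
-/

namespace Summit.MatrixMultiplication.MatrixMultiplication.Theorems.PolynomialSlack

open scoped BigOperators Matrix ComplexOrder
open Literature.Combinatorics.Additive (TripleProductProperty indicatorElem indicatorElemInv)
open Literature.NumberTheory.DiophantineGeometry (spechtCharacter numStandardTableaux)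
open Literature.RepresentationTheory.FiniteGroups
open Literature.Barriers.MatrixMultiplication
open Summit.MatrixMultiplication.MatrixMultiplication.Theorems.GlobalBranch (stub_blockDictionary)

-- `Summit.<Summit>.<Problem>` is the tree's mandated summit-side namespace (CONVENTIONS §2); for
-- this single-conjunct summit the two coincide, so each declaration silences `dupNamespace`.
set_option linter.dupNamespace false

/-- Blocks indexed by a partition which is none of `(n), (n-1,1), (1ⁿ), (2,1^{n-2})` have dimension
`≥ n(n-1)/6` (`n ≥ 40`). [folklore] -/
theorem large_dim_of_not_low {n : ℕ} (hn : 40 ≤ n) (μ : Nat.Partition n)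
    (h1 : μ.sortedParts ≠ [n]) (h2 : μ.sortedParts ≠ [n - 1, 1])
    (h3 : μ.sortedParts ≠ List.replicate n 1) (h4 : μ.sortedParts ≠ 2 :: List.replicate (n - 2) 1) :
    ((n * (n - 1) : ℕ) : ℝ) / 6 ≤ numStandardTableaux μ := by
  have hrow : ∀ a ∈ μ.parts, a + 2 ≤ n := by
    intro a ha
    by_contra hlt
    rcases sortedParts_of_exists_large_part μ ha (by omega) with h | h
    · exact h1 h
    · exact h2 h
  have hcol : μ.parts.card + 2 ≤ n := by
    by_contra hlt
    rcases sortedParts_of_card_parts_ge μ (by omega) with h | h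
    · exact h3 h
    · exact h4 h
  have key := quadratic_le_numStandardTableaux hn μ hrow hcol
  rw [div_le_iff₀ (by norm_num : (0 : ℝ) < 6)]
  exact_mod_cast (key.trans_eq (mul_comm _ _))

set_option maxHeartbeats 800000 in
/-- **Level-one pinning.** For `n ≥ 40` and a triple `S, T, U ⊆ S_n` with the triple product
property each of whose sets lies in one sign class, with `N = |S||T||U|`, `D = n(n-1)/6` and
`T₃ = Σ_{(s,t),(t',u),(u',s')} #fix(s⁻¹t·t'⁻¹u·u'⁻¹s')` the six-fold fixed-point count:
`2(n-1)(N² - T₃) ≥ 2N² - n!·N - N·n!·√(n!)/√D`. [folklore] -/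
theorem levelOnePinning (n : ℕ) (hn : 40 ≤ n) (S T U : Finset (Equiv.Perm (Fin n)))
    (hTPP : TripleProductProperty S T U)
    (hS : ∀ s ∈ S, ∀ s' ∈ S, Equiv.Perm.sign s = Equiv.Perm.sign s')
    (hT : ∀ t ∈ T, ∀ t' ∈ T, Equiv.Perm.sign t = Equiv.Perm.sign t')
    (hU : ∀ u ∈ U, ∀ u' ∈ U, Equiv.Perm.sign u = Equiv.Perm.sign u') :
    2 * (((S.card * T.card * U.card) ^ 2 : ℕ) : ℝ) - (n.factorial : ℝ) * (S.card * T.card * U.card : ℕ) -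
        (S.card * T.card * U.card : ℕ) * ((n.factorial : ℝ) * Real.sqrt (n.factorial : ℝ)) /
          Real.sqrt (((n * (n - 1) : ℕ) : ℝ) / 6) ≤
      2 * ((n : ℝ) - 1) * ((((S.card * T.card * U.card) ^ 2 : ℕ) : ℝ) -
        ((∑ y ∈ ((S ×ˢ T) ×ˢ (T ×ˢ U)) ×ˢ (U ×ˢ S),
          (Finset.univ.filter fun p : Fin n =>
            (y.1.1.1⁻¹ * y.1.1.2 * (y.1.2.1⁻¹ * y.1.2.2) * (y.2.1⁻¹ * y.2.2)) p = p).card : ℕ) : ℝ)) := by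
  classical
  -- notation
  set N : ℕ := S.card * T.card * U.card with hN
  set T₃ : ℕ := ∑ y ∈ ((S ×ˢ T) ×ˢ (T ×ˢ U)) ×ˢ (U ×ˢ S),
      (Finset.univ.filter fun p : Fin n =>
        (y.1.1.1⁻¹ * y.1.1.2 * (y.1.2.1⁻¹ * y.1.2.2) * (y.2.1⁻¹ * y.2.2)) p = p).card with hT₃
  set cG : ℝ := (n.factorial : ℝ) with hcG
  set D : ℝ := ((n * (n - 1) : ℕ) : ℝ) / 6 with hD
  have hD0 : 0 < D := by
    rw [hD]; apply div_pos _ (by norm_num)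
    have : 0 < n * (n - 1) := Nat.mul_pos (by omega) (by omega)
    exact_mod_cast this
  -- degenerate case: an empty set
  by_cases hN0 : N = 0
  · have hsix : (((S ×ˢ T) ×ˢ (T ×ˢ U)) ×ˢ (U ×ˢ S)) = ∅ := by
      rw [← Finset.card_eq_zero, card_six, ← hN, hN0]; rfl
    have hT0 : T₃ = 0 := by rw [hT₃, hsix, Finset.sum_empty]
    rw [hT0, hN0]
    simp
  have hSne : S.Nonempty := Finset.card_ne_zero.1 fun h => hN0 (by simp [hN, h])
  have hTne : T.Nonempty := Finset.card_ne_zero.1 fun h => hN0 (by simp [hN, h])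
  have hUne : U.Nonempty := Finset.card_ne_zero.1 fun h => hN0 (by simp [hN, h])
  -- a unitary Wedderburn decomposition and its dictionary with partitions
  obtain ⟨r, d, hd, φ, hφ⟩ := exists_unitary_algEquiv_pi_matrix (Equiv.Perm (Fin n))
  haveI : ∀ i, NeZero (d i) := hd
  obtain ⟨part, hbij, hchar, hdeg, -, -⟩ := stub_blockDictionary n φ hφ
  -- the three transforms and the six-fold element
  set a : ∀ i : Fin r, Matrix (Fin (d i)) (Fin (d i)) ℂ := fun i => φ (indicatorElem ℂ S) i with ha
  set t : ∀ i : Fin r, Matrix (Fin (d i)) (Fin (d i)) ℂ := fun i => φ (indicatorElem ℂ T) i with ht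
  set u : ∀ i : Fin r, Matrix (Fin (d i)) (Fin (d i)) ℂ := fun i => φ (indicatorElem ℂ U) i with hu
  set A : ∀ i : Fin r, Matrix (Fin (d i)) (Fin (d i)) ℂ := fun i => (a i)ᴴ * t i with hA
  set B : ∀ i : Fin r, Matrix (Fin (d i)) (Fin (d i)) ℂ := fun i => (t i)ᴴ * u i with hB
  set C : ∀ i : Fin r, Matrix (Fin (d i)) (Fin (d i)) ℂ := fun i => (u i)ᴴ * a i with hC
  have hPA : ∀ i, φ (indicatorElemInv ℂ S * indicatorElem ℂ T) i = A i := fun i => by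
    rw [map_mul, Pi.mul_apply, algEquiv_indicatorElemInv_eq_conjTranspose φ hφ]
  have hQB : ∀ i, φ (indicatorElemInv ℂ T * indicatorElem ℂ U) i = B i := fun i => by
    rw [map_mul, Pi.mul_apply, algEquiv_indicatorElemInv_eq_conjTranspose φ hφ]
  have hRC : ∀ i, φ (indicatorElemInv ℂ U * indicatorElem ℂ S) i = C i := fun i => by
    rw [map_mul, Pi.mul_apply, algEquiv_indicatorElemInv_eq_conjTranspose φ hφ]
  have hZ : ∀ i, φ ((indicatorElemInv ℂ S * indicatorElem ℂ T) *
      (indicatorElemInv ℂ T * indicatorElem ℂ U) * (indicatorElemInv ℂ U * indicatorElem ℂ S)) i =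
        A i * B i * C i := fun i => by
    rw [map_mul, map_mul, Pi.mul_apply, Pi.mul_apply, hPA, hQB, hRC]
  -- (1) Fourier inversion at `1` + TPP count: `|G| N = ∑ dᵢ Re tr(Aᵢ Bᵢ Cᵢ)`
  have h1 : (cG * N : ℝ) = ∑ i, (d i : ℝ) * (A i * B i * C i).trace.re := by
    have h := card_mul_coeff_one_eq_sum_trace φ
      ((indicatorElemInv ℂ S * indicatorElem ℂ T) * (indicatorElemInv ℂ T * indicatorElem ℂ U) *
        (indicatorElemInv ℂ U * indicatorElem ℂ S))
    rw [hTPP.coeff_one_six] at h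
    simp only [hZ] at h
    have h' := congrArg Complex.re h
    rw [Complex.re_sum] at h'
    rw [Fintype.card_perm, Fintype.card_fin] at h'
    simpa [hcG, hN] using h'
  -- (2) Parseval: `∑ dᵢ ‖Aᵢ‖² = |G||S||T|` and cyclically
  have h2A : ∑ i, (d i : ℝ) * ((A i)ᴴ * A i).trace.re = cG * (S.card * T.card) := by
    have h := parseval_of_adjoint φ (indicatorElemInv ℂ S * indicatorElem ℂ T)
      (indicatorElemInv ℂ T * indicatorElem ℂ S) fun i => by
      rw [hPA, map_mul, Pi.mul_apply, algEquiv_indicatorElemInv_eq_conjTranspose φ hφ, hA]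
      simp only [Matrix.conjTranspose_mul, Matrix.conjTranspose_conjTranspose]
      rfl
    rw [hTPP.coeff_one_four hUne] at h
    simp only [hPA] at h
    rw [Fintype.card_perm, Fintype.card_fin] at h
    rw [hcG]
    exact_mod_cast h
  have h2B : ∑ i, (d i : ℝ) * ((B i)ᴴ * B i).trace.re = cG * (T.card * U.card) := by
    have h := parseval_of_adjoint φ (indicatorElemInv ℂ T * indicatorElem ℂ U)
      (indicatorElemInv ℂ U * indicatorElem ℂ T) fun i => by
      rw [hQB, map_mul, Pi.mul_apply, algEquiv_indicatorElemInv_eq_conjTranspose φ hφ, hB]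
      simp only [Matrix.conjTranspose_mul, Matrix.conjTranspose_conjTranspose]
      rfl
    rw [hTPP.rotate.coeff_one_four hSne] at h
    simp only [hQB] at h
    rw [Fintype.card_perm, Fintype.card_fin] at h
    rw [hcG]
    exact_mod_cast h
  have h2C : ∑ i, (d i : ℝ) * ((C i)ᴴ * C i).trace.re = cG * (U.card * S.card) := by
    have h := parseval_of_adjoint φ (indicatorElemInv ℂ U * indicatorElem ℂ S)
      (indicatorElemInv ℂ S * indicatorElem ℂ U) fun i => by
      rw [hRC, map_mul, Pi.mul_apply, algEquiv_indicatorElemInv_eq_conjTranspose φ hφ, hC]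
      simp only [Matrix.conjTranspose_mul, Matrix.conjTranspose_conjTranspose]
      rfl
    rw [hTPP.rotate.rotate.coeff_one_four hTne] at h
    simp only [hRC] at h
    rw [Fintype.card_perm, Fintype.card_fin] at h
    rw [hcG]
    exact_mod_cast h
  -- (3) the LOW blocks: the four partitions of level `≤ 1`
  have hn1 : 1 ≤ n := by omega
  have hn2 : 2 ≤ n := by omega
  have hn3 : 3 ≤ n := by omega
  obtain ⟨μ₁, hμ₁⟩ := exists_partition_single hn1
  obtain ⟨μ₂, hμ₂⟩ := exists_partition_hook hn2
  obtain ⟨μ₃, hμ₃⟩ := exists_partition_column n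
  obtain ⟨μ₄, hμ₄⟩ := exists_partition_twoColumn hn2
  obtain ⟨i₁, hi₁⟩ := hbij.2 μ₁
  obtain ⟨i₂, hi₂⟩ := hbij.2 μ₂
  obtain ⟨i₃, hi₃⟩ := hbij.2 μ₃
  obtain ⟨i₄, hi₄⟩ := hbij.2 μ₄
  have hs₁ : (part i₁).sortedParts = [n] := by rw [hi₁, hμ₁]
  have hs₂ : (part i₂).sortedParts = [n - 1, 1] := by rw [hi₂, hμ₂]
  have hs₃ : (part i₃).sortedParts = List.replicate n 1 := by rw [hi₃, hμ₃]
  have hs₄ : (part i₄).sortedParts = 2 :: List.replicate (n - 2) 1 := by rw [hi₄, hμ₄]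
  -- the four sorted-parts lists are pairwise distinct (`n ≥ 4`)
  have hrep : List.replicate n 1 = 1 :: 1 :: List.replicate (n - 2) 1 := by
    conv_lhs => rw [show n = (n - 2) + 1 + 1 by omega]
    rfl
  have d12 : ([n] : List ℕ) ≠ [n - 1, 1] := by simp
  have d13 : ([n] : List ℕ) ≠ List.replicate n 1 := by rw [hrep]; simp
  have d14 : ([n] : List ℕ) ≠ 2 :: List.replicate (n - 2) 1 := by simp; omega
  have d23 : ([n - 1, 1] : List ℕ) ≠ List.replicate n 1 := by
    rw [hrep]; simp only [ne_eq, List.cons.injEq]; omega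
  have d24 : ([n - 1, 1] : List ℕ) ≠ 2 :: List.replicate (n - 2) 1 := by
    simp only [ne_eq, List.cons.injEq]; omega
  have d34 : List.replicate n 1 ≠ 2 :: List.replicate (n - 2) 1 := by rw [hrep]; simp
  have n12 : i₁ ≠ i₂ := fun h => d12 (by rw [← hs₁, ← hs₂, h])
  have n13 : i₁ ≠ i₃ := fun h => d13 (by rw [← hs₁, ← hs₃, h])
  have n14 : i₁ ≠ i₄ := fun h => d14 (by rw [← hs₁, ← hs₄, h])
  have n23 : i₂ ≠ i₃ := fun h => d23 (by rw [← hs₂, ← hs₃, h])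
  have n24 : i₂ ≠ i₄ := fun h => d24 (by rw [← hs₂, ← hs₄, h])
  have n34 : i₃ ≠ i₄ := fun h => d34 (by rw [← hs₃, ← hs₄, h])
  -- the predicate "low block"
  let low : Fin r → Prop := fun i => (part i).sortedParts = [n] ∨ (part i).sortedParts = [n - 1, 1] ∨
    (part i).sortedParts = List.replicate n 1 ∨ (part i).sortedParts = 2 :: List.replicate (n - 2) 1
  have hlowset : Finset.univ.filter low = ({i₁, i₂, i₃, i₄} : Finset (Fin r)) := by
    ext i
    simp only [Finset.mem_filter, Finset.mem_univ, true_and, Finset.mem_insert, Finset.mem_singleton,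
      low]
    have key : ∀ j, (part i).sortedParts = (part j).sortedParts → i = j := fun j h =>
      hbij.1 (eq_of_sortedParts_eq h)
    constructor
    · rintro (h | h | h | h)
      · exact Or.inl (key i₁ (h.trans hs₁.symm))
      · exact Or.inr (Or.inl (key i₂ (h.trans hs₂.symm)))
      · exact Or.inr (Or.inr (Or.inl (key i₃ (h.trans hs₃.symm))))
      · exact Or.inr (Or.inr (Or.inr (key i₄ (h.trans hs₄.symm))))
    · rintro (rfl | rfl | rfl | rfl)
      · exact Or.inl hs₁
      · exact Or.inr (Or.inl hs₂)
      · exact Or.inr (Or.inr (Or.inl hs₃))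
      · exact Or.inr (Or.inr (Or.inr hs₄))
  -- their exact contributions
  have hchar' : ∀ i, (blockRep φ i).character = spechtCharacter ℂ (part i) := hchar
  have hdn : ∀ i, d i = n - 1 → ((d i : ℕ) : ℝ) = (n : ℝ) - 1 := fun i h => by
    rw [h, Nat.cast_sub hn1, Nat.cast_one]
  have hd1 : ∀ i, d i = 1 → ((d i : ℕ) : ℝ) = 1 := fun i h => by rw [h, Nat.cast_one]
  have eN2 : (((N ^ 2 : ℕ) : ℂ)).re = (N : ℝ) ^ 2 := by
    rw [Complex.natCast_re]; push_cast; ring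
  have eT3 : (((T₃ : ℕ) : ℂ) - ((N ^ 2 : ℕ) : ℂ)).re = (T₃ : ℝ) - (N : ℝ) ^ 2 := by
    rw [Complex.sub_re, Complex.natCast_re, eN2]
  have e₁ : (d i₁ : ℝ) * (A i₁ * B i₁ * C i₁).trace.re = (N : ℝ) ^ 2 := by
    rw [← hZ, trace_six_of_single φ part hchar' S T U hs₁, hd1 i₁ (degree_of_single φ part hchar' hs₁),
      ← hN, eN2, one_mul]
  have e₂ : (d i₂ : ℝ) * (A i₂ * B i₂ * C i₂).trace.re = ((n : ℝ) - 1) * ((T₃ : ℝ) - (N : ℝ) ^ 2) := by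
    rw [← hZ, trace_six_of_hook φ part hchar' S T U hn2 hs₂,
      hdn i₂ (degree_of_hook φ part hchar' hn2 hs₂), ← hN, ← hT₃, eT3]
  have e₃ : (d i₃ : ℝ) * (A i₃ * B i₃ * C i₃).trace.re = (N : ℝ) ^ 2 := by
    rw [← hZ, trace_six_of_column φ part hchar' S T U hS hT hU hn1 hs₃,
      hd1 i₃ (degree_of_column φ part hchar' hn1 hs₃), ← hN, eN2, one_mul]
  have e₄ : (d i₄ : ℝ) * (A i₄ * B i₄ * C i₄).trace.re = ((n : ℝ) - 1) * ((T₃ : ℝ) - (N : ℝ) ^ 2) := by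
    rw [← hZ, trace_six_of_twoColumn φ part hchar' S T U hS hT hU hn3 hs₄,
      hdn i₄ (degree_of_twoColumn φ part hchar' hn3 hs₄), ← hN, ← hT₃, eT3]
  have hlow : ∑ i ∈ Finset.univ.filter low, (d i : ℝ) * (A i * B i * C i).trace.re =
      2 * (N : ℝ) ^ 2 + 2 * (((n : ℝ) - 1) * ((T₃ : ℝ) - (N : ℝ) ^ 2)) := by
    rw [hlowset, Finset.sum_insert (by simp [n12, n13, n14]), Finset.sum_insert (by simp [n23, n24]),
      Finset.sum_pair n34, e₁, e₂, e₃, e₄]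
    ring
  -- (4) the HIGH blocks have dimension `≥ D`
  have hhigh : ∀ i, ¬ low i → D ≤ (d i : ℝ) := by
    intro i hi
    simp only [low, not_or] at hi
    rw [hdeg i, hD]
    exact large_dim_of_not_low hn (part i) hi.1 hi.2.1 hi.2.2.1 hi.2.2.2
  -- (5) bound on each high block, as in BCGPU with `n(G)` replaced by `D`
  set K : ℝ := Real.sqrt (cG * (S.card * T.card) / D) with hK
  have h5 : ∀ i, ¬ low i → (d i : ℝ) * ‖(A i * B i * C i).trace‖ ≤
      K * (Real.sqrt (d i * ((B i)ᴴ * B i).trace.re) *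
        Real.sqrt (d i * ((C i)ᴴ * C i).trace.re)) := by
    intro i hi
    have hDle : D ≤ d i := hhigh i hi
    have hdi : (0 : ℝ) < d i := hD0.trans_le hDle
    -- `‖Aᵢ‖² ≤ |G||S||T| / D`
    have hAi : ((A i)ᴴ * A i).trace.re ≤ cG * (S.card * T.card) / D := by
      have hle : (d i : ℝ) * ((A i)ᴴ * A i).trace.re ≤ cG * (S.card * T.card) := by
        rw [← h2A]
        exact Finset.single_le_sum (f := fun j => (d j : ℝ) * ((A j)ᴴ * A j).trace.re)
          (fun j _ => mul_nonneg (Nat.cast_nonneg _) (re_trace_conjTranspose_mul_self_nonneg _))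
          (Finset.mem_univ i)
      calc ((A i)ᴴ * A i).trace.re ≤ cG * (S.card * T.card) / d i := by
            rw [le_div_iff₀ hdi, mul_comm]; exact hle
        _ ≤ cG * (S.card * T.card) / D :=
            div_le_div_of_nonneg_left (by positivity) hD0 hDle
    calc (d i : ℝ) * ‖(A i * B i * C i).trace‖
        ≤ d i * (Real.sqrt (((A i)ᴴ * A i).trace.re) *
            (Real.sqrt (((B i)ᴴ * B i).trace.re) * Real.sqrt (((C i)ᴴ * C i).trace.re))) :=
          mul_le_mul_of_nonneg_left (norm_trace_mul_mul_le _ _ _) hdi.le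
      _ ≤ d i * (K * (Real.sqrt (((B i)ᴴ * B i).trace.re) *
            Real.sqrt (((C i)ᴴ * C i).trace.re))) := by
          gcongr
          exact Real.sqrt_le_sqrt hAi
      _ = K * (Real.sqrt (d i * ((B i)ᴴ * B i).trace.re) *
            Real.sqrt (d i * ((C i)ᴴ * C i).trace.re)) := by
          rw [Real.sqrt_mul hdi.le, Real.sqrt_mul hdi.le]
          have := Real.mul_self_sqrt hdi.le
          linear_combination
            (-(K * Real.sqrt (((B i)ᴴ * B i).trace.re) * Real.sqrt (((C i)ᴴ * C i).trace.re))) *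
              this
  -- summing (5) over the high blocks, with Cauchy–Schwarz
  have h5sum : ∑ i ∈ Finset.univ.filter (fun i => ¬ low i),
      (d i : ℝ) * ‖(A i * B i * C i).trace‖ ≤
        K * (Real.sqrt (cG * (T.card * U.card)) * Real.sqrt (cG * (U.card * S.card))) := by
    calc ∑ i ∈ Finset.univ.filter (fun i => ¬ low i), (d i : ℝ) * ‖(A i * B i * C i).trace‖
        ≤ ∑ i ∈ Finset.univ.filter (fun i => ¬ low i),
            K * (Real.sqrt (d i * ((B i)ᴴ * B i).trace.re) *
              Real.sqrt (d i * ((C i)ᴴ * C i).trace.re)) :=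
          Finset.sum_le_sum fun i hi => h5 i (Finset.mem_filter.1 hi).2
      _ ≤ ∑ i, K * (Real.sqrt (d i * ((B i)ᴴ * B i).trace.re) *
            Real.sqrt (d i * ((C i)ᴴ * C i).trace.re)) :=
          Finset.sum_le_univ_sum_of_nonneg fun i => by positivity
      _ = K * ∑ i, Real.sqrt (d i * ((B i)ᴴ * B i).trace.re) *
            Real.sqrt (d i * ((C i)ᴴ * C i).trace.re) := by
          rw [Finset.mul_sum]
      _ ≤ K * (Real.sqrt (∑ i, (d i : ℝ) * ((B i)ᴴ * B i).trace.re) *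
            Real.sqrt (∑ i, (d i : ℝ) * ((C i)ᴴ * C i).trace.re)) := by
          gcongr
          exact Real.sum_sqrt_mul_sqrt_le _
            (fun i => mul_nonneg (Nat.cast_nonneg _)
              (re_trace_conjTranspose_mul_self_nonneg _))
            (fun i => mul_nonneg (Nat.cast_nonneg _)
              (re_trace_conjTranspose_mul_self_nonneg _))
      _ = K * (Real.sqrt (cG * (T.card * U.card)) * Real.sqrt (cG * (U.card * S.card))) := by
          rw [h2B, h2C]
  -- the error term equals `N |G| √|G| / √D`
  have hErr : K * (Real.sqrt (cG * (T.card * U.card)) * Real.sqrt (cG * (U.card * S.card))) =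
      N * (cG * Real.sqrt cG) / Real.sqrt D := by
    have hG0 : 0 ≤ cG := Nat.cast_nonneg _
    have hS' : (0 : ℝ) ≤ S.card := Nat.cast_nonneg _
    have hT' : (0 : ℝ) ≤ T.card := Nat.cast_nonneg _
    have hU' : (0 : ℝ) ≤ U.card := Nat.cast_nonneg _
    rw [hK, Real.sqrt_div (by positivity), Real.sqrt_mul hG0, Real.sqrt_mul hG0, Real.sqrt_mul hG0,
      Real.sqrt_mul hS', Real.sqrt_mul hT', Real.sqrt_mul hU', hN]
    push_cast
    have eG := Real.mul_self_sqrt hG0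
    have eS := Real.mul_self_sqrt hS'
    have eT := Real.mul_self_sqrt hT'
    have eU := Real.mul_self_sqrt hU'
    calc Real.sqrt cG * (Real.sqrt S.card * Real.sqrt T.card) / Real.sqrt D *
          (Real.sqrt cG * (Real.sqrt T.card * Real.sqrt U.card) *
            (Real.sqrt cG * (Real.sqrt U.card * Real.sqrt S.card)))
        = (Real.sqrt S.card * Real.sqrt S.card) * (Real.sqrt T.card * Real.sqrt T.card) *
            (Real.sqrt U.card * Real.sqrt U.card) *
            ((Real.sqrt cG * Real.sqrt cG) * Real.sqrt cG) / Real.sqrt D := by ring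
      _ = S.card * T.card * U.card * (cG * Real.sqrt cG) / Real.sqrt D := by rw [eG, eS, eT, eU]
  -- (6) assemble
  have hsplit := Finset.sum_filter_add_sum_filter_not Finset.univ low
    (fun i => (d i : ℝ) * (A i * B i * C i).trace.re)
  have hneg : -(K * (Real.sqrt (cG * (T.card * U.card)) * Real.sqrt (cG * (U.card * S.card)))) ≤
      ∑ i ∈ Finset.univ.filter (fun i => ¬ low i), (d i : ℝ) * (A i * B i * C i).trace.re := by
    refine (neg_le_neg h5sum).trans ?_
    rw [← Finset.sum_neg_distrib]
    refine Finset.sum_le_sum fun i _ => ?_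
    rw [← mul_neg]
    exact mul_le_mul_of_nonneg_left
      ((neg_le_neg (Complex.abs_re_le_norm _)).trans (neg_abs_le _)) (Nat.cast_nonneg _)
  have hmain : 2 * (N : ℝ) ^ 2 + 2 * (((n : ℝ) - 1) * ((T₃ : ℝ) - (N : ℝ) ^ 2)) -
      N * (cG * Real.sqrt cG) / Real.sqrt D ≤ cG * N := by
    rw [h1, ← hsplit, hlow, ← hErr]
    linarith
  -- conclude
  have e2 : (((N ^ 2 : ℕ) : ℝ)) = (N : ℝ) ^ 2 := by push_cast; ring
  rw [e2]
  linarith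

end Summit.MatrixMultiplication.MatrixMultiplication.Theorems.PolynomialSlack
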